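import Literature.Probability.Percolation.MeanClusterSizeTwoPoint
import Mathlib.Analysis.SpecialFunctions.Pow.Real
import Mathlib.Analysis.SpecialFunctions.Log.Basic
import Mathlib.Algebra.Order.Field.GeomSum
import HarnessLib

/-!
# Upper bound `χ^f(p) ≤ C_η L_ε(p)^{43/24 + η}` from one-arm stability, radius decay and the one-arm exponent

Topic `Literature/Probability/Percolation`; family `crit-perc`, statement **crit-perc.S16**, named fact
`Literature.Probability.Percolation.triMeanClusterSize_exponent` (`χ^f(p) = |p - 1/2|^{-43/18 + o(1)}`;
Smirnov–Werner 2001, §2, Thm. 1 (ii); Nolin 2008, §7.5). Proofs only (no definition, no named fact).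
Third brick of the bottom-up reduction of that fact to the tree's near-critical named facts (after
`MeanClusterSizeScaling.lean`, `MeanClusterSizeTwoPoint.lean`, `MeanClusterSizeExponentAssembly.lean`):
the UPPER half of Nolin's `χ(p) ≍ L(p)² π₁²(L(p))` (*Electron. J. Probab.* **13** (2008), §7.5,
Lemma 42 and Prop. 43 of arXiv 0711.4948), in the logarithmic form
`χ^f(p) ≤ C_η L_ε(p)^{43/24 + η}` (every `η > 0`; `43/24 = 2 - 2·(5/48)`, Nolin's display after
Prop. 43: `χ(p) ≈ L(p)² [L(p)^{-5/48}]²`) consumed by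
`MeanClusterSizeExponentAssembly.triMeanClusterSize_exponent_of_powerBounds`.

## Statement (`triMeanClusterSize_le_rpow_at`, `triMeanClusterSize_le_rpow`)

From the one-arm exponent `oneArm_exponent` (`π₁(m) = m^{-5/48 + o(1)}`), the near-critical stability
of one arm below `L_ε(p)` (the body of `Nolin2008_thm27_oneArm` at `ε`; only its upper half
`P_p(0 ↔ ∂Λ_N) ≤ C₁ π₁(N)`, `N ≤ L_ε(p)`, is used) and the radius decay of the finite cluster beyond
`L_ε(p)` (`Nolin2008_radius_decay_at ε`, itself proved in the tree from Nolin's Lemma 39 at `ε`,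
`Nolin2008_radius_decay_at_of_lemma39_at'`): for every `η > 0` there are `δ > 0`, `L₀`, `C` with
`χ^f(p) ≤ C · L_ε(p)^{43/24 + η}` whenever `p ≠ 1/2`, `|p - 1/2| < δ` and `L_ε(p) ≥ L₀`.

## Proof (Nolin 2008, §7.5, proof of Lemma 42, with two simplifications)

`χ^f(p) = Σ_x P_p(0 ↔ x, |C(0)| < ∞)` (`triMeanClusterSize_eq_tsum`); it suffices to bound the finite
sums over the rhombi `S_N` uniformly in `N` (`ENNReal.tsum_eq_iSup_sum`). Sites are sorted by the
sup norm `ρ(x) = max(|x₀|, |x₁|)` into the square shells `S_{t+1} ∖ S_t` (`8t + 8` sites) and, far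
away, into the thick shells `S_{(k+1)L-1} ∖ S_{kL-1}` (`≤ 4(k+1)²L²` sites); the book-keeping is the
elementary `sum_le_sum_add_sum_shells`.

* *Near shells* (`2M₀ + 3 ≤ t`, `t + 1 = ρ(x)`; `real_triFinConn_le_of_mem_shell`): with
  `m = min(L, ⌊t/2⌋)` the hexagons `Λ_m` and `x + Λ_m` are disjoint (`2m < t + 1 ≤ |x|_𝕋`), so
  `P_p(0 ↔ x) ≤ P_p(0 ↔ ∂Λ_m)²` (Nolin (7.27); the tree's `real_triFinConn_le_sq`)
  `≤ C₁² π₁(m)² ≤ C₁² m^{-5/24 + η/2} ≤ C₁² (3^s (t+1)^{-s} + L^{-s})`, `s = 5/24 - η/2`, by one-arm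
  stability (`m ≤ L`) and the one-arm exponent (`m ≥ M₀`); summed (`near_shell_sum_le`) up to
  `T = k₀L - 1`: `≤ 32 C₁² k₀² L^{2-s}`.
* *Far shells* (`k ≥ k₀`; `triFinConn_subset_triBoxArm_of_mem_shell`): a site with `ρ(x) ≥ kL` forces
  `{0 ↝ ∂S_{kL}, |C(0)| < ∞}`, of probability `≤ C e^{-ck}` (radius decay); summed
  (`far_shell_sum_le`, `sum_Ico_sq_mul_exp_le`): `≤ 4C(32/c²) L² e^{-ck₀/2}/(1 - e^{-c/2})`.
* With `k₀ = ⌈(4/c) log L⌉ + 1` one has `L² e^{-ck₀/2} ≤ 1` and `k₀² ≤ (16/(cη) + 2)² L^{η/2}`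
  (`sq_le_rpow_of_le_log`), whence the total `≤ (2R₀+1)² + 32 C₁² (16/(cη)+2)² L^{43/24 + η} + O(1)`.

The two simplifications with respect to the printed proof: (i) Nolin's a-priori bound
`π₁(n|N) ≥ C(n/N)^{1/2}` and the quasi-multiplicativity of `π₁` (his Lemma 41), which give the
sharp `Σ_{x ∈ S_L} P(0 ↔ x) ≍ L² π₁²(L)`, are replaced by the one-arm exponent itself, at the cost of
the factor `L^η`; (ii) the tiling of the plane by translates of `S_L` and item 1 of Lemma 41 are
replaced by the radius decay from the origin applied only beyond the scale `k₀ L ≍ L log L`, the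
sites with `L < ρ < k₀L` being treated like the near ones with `m = L` (cost: the factor `k₀²`).
Both losses are invisible in the exponent `γ = 43/18`.

## References

* P. Nolin, Near-critical percolation in two dimensions, *Electron. J. Probab.* 13 (2008)
  1562–1623, §7.5, Lemmas 41–42, Prop. 43 and the display after it (arXiv 0711.4948 numbering;
  the EJP numbers are shifted by two) [Nolin2008].
* S. Smirnov, W. Werner, Critical exponents for two-dimensional percolation, *Math. Res. Lett.* 8
  (2001), §2, Thm. 1 (ii) of arXiv:math/0109120 [SmirnovWernerMRL2001].
* G. F. Lawler, O. Schramm, W. Werner, One-arm exponent for critical 2D percolation, *Electron. J.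
  Probab.* 7 (2002), Thm. 1.1 [LawlerSchrammWernerEJP2002].
* H. Kesten, Scaling relations for 2D-percolation, *Comm. Math. Phys.* 109 (1987) [KestenScalingCMP1987].

## Mathlib / tree

Mathlib: `Real.rpow` API (`rpow_le_rpow_of_nonpos`, `log_le_rpow_div`, `mul_rpow`, …),
`geom_sum_Ico_le_of_lt_one`, `Real.quadratic_le_exp_of_nonneg`, `ENNReal.tsum_eq_iSup_sum`,
`Finset.sum_sdiff`, `Nat.le_induction`, `card_box`. Tree: `triMeanClusterSize_eq_tsum`,
`real_triFinConn_le_sq`, `triFinConn_subset_triBoxArm_inter` (`MeanClusterSizeTwoPoint.lean`),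
`Nolin2008_radius_decay_at`, `triBoxArm` (`NearCriticalCorrelationLength.lean`), `Nolin2008_thm27_oneArm`,
`critOneArmProb` (`NearCriticalScaling.lean`, `KestenScaling.lean`), `hasDecayExponent_eventually_pos`.
-/

noncomputable section

open MeasureTheory Set Filter Topology
open scoped ENNReal

namespace Literature.Probability.Percolation

open LatticeModels

/-! ### Real-analysis and counting helpers -/

/-- From the one-arm exponent `π₁(m) = m^{-5/48 + o(1)}`: for every `η > 0`,
`π₁(m) ≤ m^{-5/48 + η}` for all large `m`. [cite: LawlerSchrammWernerEJP2002, Thm. 1.1] -/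
theorem critOneArmProb_le_rpow_of_oneArm_exponent (h₁ : oneArm_exponent) {η : ℝ} (hη : 0 < η) :
    ∃ M₀ : ℕ, 1 ≤ M₀ ∧ ∀ m : ℕ, M₀ ≤ m → critOneArmProb m ≤ (m : ℝ) ^ (-(5 / 48 : ℝ) + η) := by
  have h : HasDecayExponent critOneArmProb (5 / 48) := h₁
  have hev : ∀ᶠ m : ℕ in atTop, Real.log (critOneArmProb m) / Real.log m < -(5 / 48) + η :=
    h.eventually (gt_mem_nhds (by linarith))
  have hpos : ∀ᶠ m : ℕ in atTop, 0 < critOneArmProb m :=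
    hasDecayExponent_eventually_pos h (by norm_num) (fun _ => measureReal_nonneg)
  obtain ⟨M₀, hM₀⟩ := eventually_atTop.1 (hev.and (hpos.and (eventually_ge_atTop 2)))
  refine ⟨max M₀ 1, le_max_right _ _, fun m hm => ?_⟩
  obtain ⟨hlt, hπ, hm2⟩ := hM₀ m ((le_max_left _ _).trans hm)
  have hm' : (1 : ℝ) < m := by exact_mod_cast (show 1 < m by omega)
  have hlogm : 0 < Real.log m := Real.log_pos hm'
  rw [div_lt_iff₀ hlogm] at hlt
  have hm0 : (0 : ℝ) < m := by linarith
  rw [Real.rpow_def_of_pos hm0, ← Real.exp_log hπ]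
  exact Real.exp_le_exp.2 (by linarith [mul_comm (Real.log m) (-(5 / 48 : ℝ) + η)])

/-- **Shell decomposition.** For an increasing sequence of finite sets `B k`, a nonnegative `F` and
bounds `F ≤ G k` on the shells `B (k+1) \ B k` (`k ≥ k₀`):
`Σ_{B K} F ≤ Σ_{B k₀} F + Σ_{k₀ ≤ k < K} |B (k+1) \ B k| · G k`. [folklore] -/
theorem sum_le_sum_add_sum_shells {α : Type*} [DecidableEq α] (B : ℕ → Finset α) (hB : Monotone B)
    (F : α → ℝ) (G : ℕ → ℝ) (k₀ : ℕ)
    (hG : ∀ k, k₀ ≤ k → ∀ x ∈ B (k + 1) \ B k, F x ≤ G k) :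
    ∀ K, k₀ ≤ K → ∑ x ∈ B K, F x ≤
      ∑ x ∈ B k₀, F x + ∑ k ∈ Finset.Ico k₀ K, (((B (k + 1) \ B k).card : ℕ) : ℝ) * G k := by
  intro K hK
  induction K, hK using Nat.le_induction with
  | base => simp
  | succ K hK ih =>
    rw [Finset.sum_Ico_succ_top hK, ← Finset.sum_sdiff (hB (Nat.le_succ K))]
    have hshell : ∑ x ∈ B (K + 1) \ B K, F x ≤ (((B (K + 1) \ B K).card : ℕ) : ℝ) * G K := by
      have := Finset.sum_le_card_nsmul (B (K + 1) \ B K) F (G K) (hG K hK)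
      rwa [nsmul_eq_mul] at this
    linarith

/-- The sup-norm shells of `ℤ²`: `|S_{t+1} \ S_t| = 8t + 8` (`|S_t| = (2t+1)²`). [folklore] -/
theorem card_box_succ_sdiff (t : ℕ) : ((box 2 (t + 1) \ box 2 t).card : ℝ) = 8 * t + 8 := by
  have h := Finset.card_sdiff_add_card_eq_card (box_mono 2 (Nat.le_succ t))
  rw [card_box, card_box] at h
  have h' : ((box 2 (t + 1) \ box 2 t).card : ℝ) + ((2 * t + 1) ^ 2 : ℕ) = ((2 * (t + 1) + 1) ^ 2 : ℕ) := by
    exact_mod_cast h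
  push_cast at h'
  nlinarith [h']

/-- A site outside the rhombus `S_n` has a coordinate of absolute value `> n`. [folklore] -/
theorem exists_lt_abs_of_not_mem_box {n : ℕ} {x : Site 2} (hx : x ∉ box 2 n) :
    ∃ i, (n : ℤ) < |x i| := by
  rw [mem_box, not_forall] at hx
  obtain ⟨i, hi⟩ := hx
  refine ⟨i, ?_⟩
  rw [not_and_or, not_le, not_le] at hi
  rcases hi with hi | hi
  · rw [lt_abs]; right; linarith
  · rw [lt_abs]; left; exact hi

/-- `|x_i| ≤ |x|_𝕋` for both coordinates. [folklore] -/
theorem abs_apply_le_triNorm (x : Site 2) (i : Fin 2) : |x i| ≤ triNorm x := by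
  fin_cases i
  · exact le_max_left _ _
  · exact (le_max_left _ _).trans (le_max_right _ _)

/-- Every finite set of sites lies in some rhombus `S_N`. [folklore] -/
theorem exists_subset_box (s : Finset (Site 2)) : ∃ N : ℕ, s ⊆ box 2 N := by
  refine ⟨s.sup fun x => max (x 0).natAbs (x 1).natAbs, fun x hx => ?_⟩
  rw [mem_box]
  have hle : max (x 0).natAbs (x 1).natAbs ≤ s.sup fun x => max (x 0).natAbs (x 1).natAbs :=
    Finset.le_sup (f := fun x : Site 2 => max (x 0).natAbs (x 1).natAbs) hx
  have hi : ∀ i : Fin 2, (x i).natAbs ≤ max (x 0).natAbs (x 1).natAbs := by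
    intro i
    fin_cases i
    · exact le_max_left _ _
    · exact le_max_right _ _
  intro i
  have := (hi i).trans hle
  omega

/-- `(k+1)² e^{-ck/2} ≤ 32/c²` for `k ≥ 1`, `c > 0` (from `e^u ≥ u²/2`). [folklore] -/
theorem sq_mul_exp_neg_le {c : ℝ} (hc : 0 < c) {k : ℕ} (hk : 1 ≤ k) :
    ((k : ℝ) + 1) ^ 2 * Real.exp (-(c * k / 2)) ≤ 32 / c ^ 2 := by
  have hk' : (1 : ℝ) ≤ k := by exact_mod_cast hk
  set u : ℝ := c * k / 2 with hu
  have hu0 : 0 ≤ u := by positivity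
  -- `e^u ≥ 1 + u + u²/2 ≥ u²/2`
  have hexp : u ^ 2 / 2 ≤ Real.exp u := by
    have := Real.quadratic_le_exp_of_nonneg hu0
    linarith [this]
  have hupos : 0 < u ^ 2 / 2 := by positivity
  rw [Real.exp_neg]
  have h1 : ((k : ℝ) + 1) ^ 2 * (Real.exp u)⁻¹ ≤ ((k : ℝ) + 1) ^ 2 * (u ^ 2 / 2)⁻¹ :=
    mul_le_mul_of_nonneg_left (inv_anti₀ hupos hexp) (by positivity)
  refine h1.trans ?_
  have hk0 : (0 : ℝ) < k := by linarith
  have hk2 : ((k : ℝ) + 1) ^ 2 ≤ 4 * (k : ℝ) ^ 2 := by nlinarith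
  have hrw : ((k : ℝ) + 1) ^ 2 * (u ^ 2 / 2)⁻¹ = 8 * ((k : ℝ) + 1) ^ 2 / (c ^ 2 * (k : ℝ) ^ 2) := by
    rw [hu]
    field_simp
    ring
  rw [hrw, div_le_div_iff₀ (by positivity) (by positivity)]
  have h8 : 8 * ((k : ℝ) + 1) ^ 2 * c ^ 2 ≤ 8 * (4 * (k : ℝ) ^ 2) * c ^ 2 :=
    mul_le_mul_of_nonneg_right (mul_le_mul_of_nonneg_left hk2 (by norm_num)) (sq_nonneg c)
  linarith

/-- Geometric tail with a quadratic weight: `Σ_{k₀ ≤ k < K} (k+1)² e^{-ck} ≤ (32/c²) e^{-ck₀/2} / (1 - e^{-c/2})`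
for `k₀ ≥ 1`. [folklore] -/
theorem sum_Ico_sq_mul_exp_le {c : ℝ} (hc : 0 < c) {k₀ : ℕ} (hk₀ : 1 ≤ k₀) (K : ℕ) :
    ∑ k ∈ Finset.Ico k₀ K, ((k : ℝ) + 1) ^ 2 * Real.exp (-(c * k)) ≤
      32 / c ^ 2 * (Real.exp (-(c * k₀ / 2)) / (1 - Real.exp (-(c / 2)))) := by
  have hq0 : 0 ≤ Real.exp (-(c / 2)) := (Real.exp_pos _).le
  have hq1 : Real.exp (-(c / 2)) < 1 := Real.exp_lt_one_iff.2 (by linarith)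
  calc ∑ k ∈ Finset.Ico k₀ K, ((k : ℝ) + 1) ^ 2 * Real.exp (-(c * k))
      ≤ ∑ k ∈ Finset.Ico k₀ K, 32 / c ^ 2 * Real.exp (-(c / 2)) ^ k := by
        refine Finset.sum_le_sum fun k hk => ?_
        have hk1 : 1 ≤ k := hk₀.trans (Finset.mem_Ico.1 hk).1
        have hsplit : Real.exp (-(c * k)) = Real.exp (-(c * k / 2)) * Real.exp (-(c / 2)) ^ k := by
          rw [← Real.exp_nat_mul, ← Real.exp_add]
          congr 1; ring
        rw [hsplit, ← mul_assoc]
        exact mul_le_mul_of_nonneg_right (sq_mul_exp_neg_le hc hk1) (pow_nonneg hq0 _)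
    _ = 32 / c ^ 2 * ∑ k ∈ Finset.Ico k₀ K, Real.exp (-(c / 2)) ^ k := by rw [Finset.mul_sum]
    _ ≤ 32 / c ^ 2 * (Real.exp (-(c / 2)) ^ k₀ / (1 - Real.exp (-(c / 2)))) :=
        mul_le_mul_of_nonneg_left (geom_sum_Ico_le_of_lt_one hq0 hq1) (by positivity)
    _ = 32 / c ^ 2 * (Real.exp (-(c * k₀ / 2)) / (1 - Real.exp (-(c / 2)))) := by
        rw [← Real.exp_nat_mul]
        congr 3; ring

/-! ### Per-site bounds on the two kinds of shells -/

/-- **Far shells.** A site of `S_{(k+1)L-1} ∖ S_{kL-1}` (`k, L ≥ 1`) has a coordinate of absolute value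
`≥ kL`, so `{0 ↔ x, |C(0)| < ∞} ⊆ {0 ↝ ∂S_{kL}} ∩ {|C(0)| < ∞}`. [cite: Nolin2008, §7.5, proof of Lemma 42 (arXiv 0711.4948 numbering)] -/
theorem triFinConn_subset_triBoxArm_of_mem_shell {L k : ℕ} (hL : 1 ≤ L) (hk : 1 ≤ k) {x : Site 2}
    (hx : x ∈ box 2 ((k + 1) * L - 1) \ box 2 (k * L - 1)) :
    triFinConn 0 x ⊆ triBoxArm (k * L) ∩ (sitePercolatesAt triGraph 0)ᶜ := by
  rw [Finset.mem_sdiff] at hx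
  have hkL : 1 ≤ k * L := Nat.mul_le_mul hk hL
  obtain ⟨i, hi⟩ := exists_lt_abs_of_not_mem_box hx.2
  have hcast : ((k * L - 1 : ℕ) : ℤ) = ((k * L : ℕ) : ℤ) - 1 := by
    rw [Nat.cast_sub hkL]; push_cast; ring
  have hi' : ((k * L : ℕ) : ℤ) ≤ |x i| := by rw [hcast] at hi; omega
  exact triFinConn_subset_triBoxArm_inter hkL ⟨i, hi'⟩

/-- **Near shells.** For a site `x` of the square shell `S_{t+1} ∖ S_t` with `2M₀ + 3 ≤ t`, under the
one-arm stability `P_p(0 ↔ ∂Λ_m) ≤ C₁ π₁(m)` for `m ≤ L` and the bound `π₁(m) ≤ m^{-5/48 + η/4}` for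
`m ≥ M₀` (`M₀ ≤ L`): `P_p(0 ↔ x, |C(0)| < ∞) ≤ C₁² (3^s (t+1)^{-s} + L^{-s})`, `s = 5/24 - η/2 > 0`,
through the two disjoint hexagons of radius `m = min(L, ⌊t/2⌋) ≥ (t+1)/3` (`real_triFinConn_le_sq`). [cite: Nolin2008, §7.5, proof of Lemma 41, item 2 (arXiv 0711.4948 numbering)] -/
theorem real_triFinConn_le_of_mem_shell (p : unitInterval) {L M₀ t : ℕ} {C₁ η : ℝ} (hL1 : 1 ≤ L)
    (hM₀1 : 1 ≤ M₀) (hLM : M₀ ≤ L) (ht : 2 * M₀ + 3 ≤ t) (hη : η < 5 / 12)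
    (harm : ∀ m : ℕ, m ≤ L → (triSitePercolation p).real (triOneArm m) ≤ C₁ * critOneArmProb m)
    (hM₀ : ∀ m : ℕ, M₀ ≤ m → critOneArmProb m ≤ (m : ℝ) ^ (-(5 / 48 : ℝ) + η / 4))
    {x : Site 2} (hx : x ∈ box 2 (t + 1) \ box 2 t) :
    (triSitePercolation p).real (triFinConn 0 x) ≤
      C₁ ^ 2 * ((3 : ℝ) ^ (5 / 24 - η / 2) * ((t : ℝ) + 1) ^ (-(5 / 24 - η / 2)) +
        (L : ℝ) ^ (-(5 / 24 - η / 2))) := by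
  rw [Finset.mem_sdiff] at hx
  obtain ⟨i, hi⟩ := exists_lt_abs_of_not_mem_box hx.2
  have hxn : (t : ℤ) + 1 ≤ triNorm x := by
    have := abs_apply_le_triNorm x i; omega
  have ht5 : 5 ≤ t := by omega
  have hs0 : 0 < (5 : ℝ) / 24 - η / 2 := by linarith
  -- the radius `m`
  obtain ⟨m, hm⟩ : ∃ m : ℕ, m = min L (t / 2) := ⟨_, rfl⟩
  have hm1 : 1 ≤ m := by rw [hm]; exact le_min hL1 (by omega)
  have hmM : M₀ ≤ m := by rw [hm]; exact le_min hLM (by omega)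
  have hmL : m ≤ L := by rw [hm]; exact min_le_left _ _
  have hmt : m ≤ t / 2 := by rw [hm]; exact min_le_right _ _
  have h2m : 2 * (m : ℤ) < triNorm x := by
    have h2 : 2 * m ≤ t := by omega
    have h3 : (2 * m : ℤ) ≤ t := by exact_mod_cast h2
    omega
  have hm0 : (0 : ℝ) < m := by exact_mod_cast hm1
  have hL0 : (0 : ℝ) < L := by exact_mod_cast hL1
  -- `P ≤ P(0 ↔ ∂Λ_m)² ≤ (C₁ π₁(m))² ≤ C₁² m^{-s}`
  have hP := real_triFinConn_le_sq p hm1 h2m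
  have hsq1 : ((triSitePercolation p).real (triOneArm m)) ^ 2 ≤ (C₁ * critOneArmProb m) ^ 2 :=
    pow_le_pow_left₀ measureReal_nonneg (harm m hmL) 2
  have hsq2 : (critOneArmProb m) ^ 2 ≤ ((m : ℝ) ^ (-(5 / 48 : ℝ) + η / 4)) ^ 2 :=
    pow_le_pow_left₀ measureReal_nonneg (hM₀ m hmM) 2
  have hms : ((m : ℝ) ^ (-(5 / 48 : ℝ) + η / 4)) ^ 2 = (m : ℝ) ^ (-(5 / 24 - η / 2)) := by
    rw [sq, ← Real.rpow_add hm0]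
    congr 1; ring
  have hfx : (triSitePercolation p).real (triFinConn 0 x) ≤ C₁ ^ 2 * (m : ℝ) ^ (-(5 / 24 - η / 2)) := by
    calc (triSitePercolation p).real (triFinConn 0 x)
        ≤ ((triSitePercolation p).real (triOneArm m)) ^ 2 := hP
      _ ≤ (C₁ * critOneArmProb m) ^ 2 := hsq1
      _ = C₁ ^ 2 * (critOneArmProb m) ^ 2 := by ring
      _ ≤ C₁ ^ 2 * ((m : ℝ) ^ (-(5 / 48 : ℝ) + η / 4)) ^ 2 :=
          mul_le_mul_of_nonneg_left hsq2 (sq_nonneg _)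
      _ = C₁ ^ 2 * (m : ℝ) ^ (-(5 / 24 - η / 2)) := by rw [hms]
  -- `m^{-s} ≤ 3^s (t+1)^{-s} + L^{-s}`
  have hbound : (m : ℝ) ^ (-(5 / 24 - η / 2)) ≤
      (3 : ℝ) ^ (5 / 24 - η / 2) * ((t : ℝ) + 1) ^ (-(5 / 24 - η / 2)) + (L : ℝ) ^ (-(5 / 24 - η / 2)) := by
    have hA : 0 ≤ (3 : ℝ) ^ (5 / 24 - η / 2) * ((t : ℝ) + 1) ^ (-(5 / 24 - η / 2)) :=
      mul_nonneg (Real.rpow_nonneg (by norm_num) _) (Real.rpow_nonneg (by positivity) _)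
    have hB : 0 ≤ (L : ℝ) ^ (-(5 / 24 - η / 2)) := Real.rpow_nonneg hL0.le _
    by_cases hcase : t / 2 ≤ L
    · have hmeq : m = t / 2 := by rw [hm]; exact min_eq_right hcase
      have h3 : (t : ℝ) + 1 ≤ 3 * (m : ℝ) := by
        have : t + 1 ≤ 3 * (t / 2) := by omega
        rw [hmeq]; exact_mod_cast this
      have hle : ((t : ℝ) + 1) / 3 ≤ m := by linarith
      have hpos : 0 < ((t : ℝ) + 1) / 3 := by positivity
      have h1 : (m : ℝ) ^ (-(5 / 24 - η / 2)) ≤ (((t : ℝ) + 1) / 3) ^ (-(5 / 24 - η / 2)) :=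
        Real.rpow_le_rpow_of_nonpos hpos hle (by linarith)
      have h2 : (((t : ℝ) + 1) / 3) ^ (-(5 / 24 - η / 2)) =
          (3 : ℝ) ^ (5 / 24 - η / 2) * ((t : ℝ) + 1) ^ (-(5 / 24 - η / 2)) := by
        rw [Real.div_rpow (by positivity) (by norm_num), Real.rpow_neg (by norm_num : (0 : ℝ) ≤ 3),
          div_inv_eq_mul, mul_comm]
      linarith [h1, h2]
    · have hmeq : m = L := by rw [hm]; exact min_eq_left (le_of_lt (not_le.1 hcase))
      rw [hmeq]; linarith
  exact hfx.trans (mul_le_mul_of_nonneg_left hbound (sq_nonneg _))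

/-! ### The two shell sums -/

/-- `|S_{(k+1)L-1}| ≤ 4 (k+1)² L²`. [folklore] -/
theorem card_box_far_le {L : ℕ} (hL : 1 ≤ L) (k : ℕ) :
    ((box 2 ((k + 1) * L - 1)).card : ℝ) ≤ 4 * ((k : ℝ) + 1) ^ 2 * (L : ℝ) ^ 2 := by
  have hkL : 1 ≤ (k + 1) * L := Nat.mul_le_mul (Nat.succ_le_succ (Nat.zero_le k)) hL
  have h2 : (box 2 ((k + 1) * L - 1)).card = (2 * ((k + 1) * L - 1) + 1) ^ 2 := card_box 2 _
  have h3 : ((2 * ((k + 1) * L - 1) + 1 : ℕ) : ℝ) = 2 * (((k : ℝ) + 1) * L) - 1 := by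
    rw [Nat.cast_add, Nat.cast_mul, Nat.cast_sub hkL]; push_cast; ring
  rw [h2, Nat.cast_pow, h3]
  have hkL' : (1 : ℝ) ≤ ((k : ℝ) + 1) * L := by exact_mod_cast hkL
  nlinarith

/-- **The far sum is bounded**: with `k₀ ≥ (4/c) log L`,
`Σ_{k₀ ≤ k < K} |S_{(k+1)L-1} ∖ S_{kL-1}| · C e^{-ck} ≤ 4 C (32/c²) / (1 - e^{-c/2})`. [folklore] -/
theorem far_shell_sum_le {L k₀ : ℕ} {C c : ℝ} (hL1 : 1 ≤ L) (hk₀1 : 1 ≤ k₀) (hC : 0 < C) (hc : 0 < c)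
    (hk₀log : 4 / c * Real.log L ≤ k₀) (K : ℕ) :
    ∑ k ∈ Finset.Ico k₀ K,
        (((box 2 ((k + 1) * L - 1) \ box 2 (k * L - 1)).card : ℕ) : ℝ) * (C * Real.exp (-(c * k))) ≤
      4 * C * (32 / c ^ 2) / (1 - Real.exp (-(c / 2))) := by
  have hL0 : (0 : ℝ) < L := by exact_mod_cast hL1
  have hq1 : Real.exp (-(c / 2)) < 1 := Real.exp_lt_one_iff.2 (by linarith)
  have h1q : 0 < 1 - Real.exp (-(c / 2)) := by linarith
  have hcard : ∀ k, (((box 2 ((k + 1) * L - 1) \ box 2 (k * L - 1)).card : ℕ) : ℝ) ≤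
      4 * ((k : ℝ) + 1) ^ 2 * (L : ℝ) ^ 2 := fun k =>
    le_trans (by exact_mod_cast Finset.card_le_card Finset.sdiff_subset) (card_box_far_le hL1 k)
  have hexp : (L : ℝ) ^ 2 * Real.exp (-(c * k₀ / 2)) ≤ 1 := by
    have h1 : 2 * Real.log L ≤ c * k₀ / 2 := by
      have := mul_le_mul_of_nonneg_left hk₀log (by positivity : 0 ≤ c / 2)
      have h' : c / 2 * (4 / c * Real.log L) = 2 * Real.log L := by
        field_simp
        ring
      linarith
    have h2 : (2 : ℝ) * Real.log L = Real.log ((L : ℝ) ^ 2) := by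
      rw [Real.log_pow]; norm_num
    calc (L : ℝ) ^ 2 * Real.exp (-(c * k₀ / 2)) ≤ (L : ℝ) ^ 2 * Real.exp (-(2 * Real.log L)) :=
          mul_le_mul_of_nonneg_left (Real.exp_le_exp.2 (by linarith)) (by positivity)
      _ = 1 := by
          rw [h2, Real.exp_neg, Real.exp_log (by positivity), mul_inv_cancel₀ (by positivity)]
  calc ∑ k ∈ Finset.Ico k₀ K,
        (((box 2 ((k + 1) * L - 1) \ box 2 (k * L - 1)).card : ℕ) : ℝ) * (C * Real.exp (-(c * k)))
      ≤ ∑ k ∈ Finset.Ico k₀ K, 4 * ((k : ℝ) + 1) ^ 2 * (L : ℝ) ^ 2 * (C * Real.exp (-(c * k))) :=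
        Finset.sum_le_sum fun k _ => mul_le_mul_of_nonneg_right (hcard k) (by positivity)
    _ = 4 * (L : ℝ) ^ 2 * C * ∑ k ∈ Finset.Ico k₀ K, ((k : ℝ) + 1) ^ 2 * Real.exp (-(c * k)) := by
        rw [Finset.mul_sum]
        exact Finset.sum_congr rfl fun k _ => by ring
    _ ≤ 4 * (L : ℝ) ^ 2 * C * (32 / c ^ 2 * (Real.exp (-(c * k₀ / 2)) / (1 - Real.exp (-(c / 2))))) :=
        mul_le_mul_of_nonneg_left (sum_Ico_sq_mul_exp_le hc hk₀1 K) (by positivity)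
    _ = (4 * C * (32 / c ^ 2) / (1 - Real.exp (-(c / 2)))) * ((L : ℝ) ^ 2 * Real.exp (-(c * k₀ / 2))) := by
        field_simp
    _ ≤ (4 * C * (32 / c ^ 2) / (1 - Real.exp (-(c / 2)))) * 1 :=
        mul_le_mul_of_nonneg_left hexp (by positivity)
    _ = 4 * C * (32 / c ^ 2) / (1 - Real.exp (-(c / 2))) := mul_one _

/-- **The near sum**: for `0 < s ≤ 1`, `1 ≤ T ≤ k₀ L`, `k₀ ≥ 1`, `L ≥ 1`,
`Σ_{R₀ ≤ t < T} (8t + 8) · C₁² (3^s (t+1)^{-s} + L^{-s}) ≤ 32 C₁² k₀² L^{2-s}`. [folklore] -/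
theorem near_shell_sum_le {R₀ T L k₀ : ℕ} {C₁ s : ℝ} (hs0 : 0 < s) (hs1 : s ≤ 1) (hT1 : 1 ≤ T)
    (hT : T ≤ k₀ * L) (hL1 : 1 ≤ L) (hk₀1 : 1 ≤ k₀) :
    ∑ t ∈ Finset.Ico R₀ T, (((box 2 (t + 1) \ box 2 t).card : ℕ) : ℝ) *
        (C₁ ^ 2 * ((3 : ℝ) ^ s * ((t : ℝ) + 1) ^ (-s) + (L : ℝ) ^ (-s))) ≤
      32 * C₁ ^ 2 * (k₀ : ℝ) ^ 2 * (L : ℝ) ^ (2 - s) := by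
  have hL0 : (0 : ℝ) < L := by exact_mod_cast hL1
  have hT0 : (0 : ℝ) < T := by exact_mod_cast hT1
  have hTr : (T : ℝ) ≤ (k₀ : ℝ) * L := by exact_mod_cast hT
  have hk₀1r : (1 : ℝ) ≤ k₀ := by exact_mod_cast hk₀1
  have h3s : 0 ≤ (3 : ℝ) ^ s := Real.rpow_nonneg (by norm_num) _
  have hLs : 0 ≤ (L : ℝ) ^ (-s) := Real.rpow_nonneg hL0.le _
  -- each term is at most `8 C₁² (3^s T^{1-s} + T L^{-s})`
  have hterm : ∀ t ∈ Finset.Ico R₀ T, (((box 2 (t + 1) \ box 2 t).card : ℕ) : ℝ) *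
      (C₁ ^ 2 * ((3 : ℝ) ^ s * ((t : ℝ) + 1) ^ (-s) + (L : ℝ) ^ (-s))) ≤
      8 * C₁ ^ 2 * ((3 : ℝ) ^ s * (T : ℝ) ^ (1 - s) + (T : ℝ) * (L : ℝ) ^ (-s)) := by
    intro t ht
    have htT : t + 1 ≤ T := (Finset.mem_Ico.1 ht).2
    have htT' : (t : ℝ) + 1 ≤ T := by exact_mod_cast htT
    have ht0 : (0 : ℝ) < (t : ℝ) + 1 := by positivity
    rw [card_box_succ_sdiff t]
    have hpow : ((t : ℝ) + 1) * ((t : ℝ) + 1) ^ (-s) = ((t : ℝ) + 1) ^ (1 - s) := by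
      rw [sub_eq_add_neg, Real.rpow_add ht0, Real.rpow_one]
    have h1s : ((t : ℝ) + 1) ^ (1 - s) ≤ (T : ℝ) ^ (1 - s) :=
      Real.rpow_le_rpow ht0.le htT' (by linarith)
    have h2 : ((t : ℝ) + 1) * (L : ℝ) ^ (-s) ≤ (T : ℝ) * (L : ℝ) ^ (-s) :=
      mul_le_mul_of_nonneg_right htT' hLs
    have h12 : (3 : ℝ) ^ s * ((t : ℝ) + 1) ^ (1 - s) + ((t : ℝ) + 1) * (L : ℝ) ^ (-s) ≤
        (3 : ℝ) ^ s * (T : ℝ) ^ (1 - s) + (T : ℝ) * (L : ℝ) ^ (-s) :=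
      add_le_add (mul_le_mul_of_nonneg_left h1s h3s) h2
    calc (8 * (t : ℝ) + 8) * (C₁ ^ 2 * ((3 : ℝ) ^ s * ((t : ℝ) + 1) ^ (-s) + (L : ℝ) ^ (-s)))
        = 8 * C₁ ^ 2 * ((3 : ℝ) ^ s * (((t : ℝ) + 1) * ((t : ℝ) + 1) ^ (-s)) +
            ((t : ℝ) + 1) * (L : ℝ) ^ (-s)) := by ring
      _ = 8 * C₁ ^ 2 * ((3 : ℝ) ^ s * ((t : ℝ) + 1) ^ (1 - s) + ((t : ℝ) + 1) * (L : ℝ) ^ (-s)) := by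
          rw [hpow]
      _ ≤ 8 * C₁ ^ 2 * ((3 : ℝ) ^ s * (T : ℝ) ^ (1 - s) + (T : ℝ) * (L : ℝ) ^ (-s)) :=
          mul_le_mul_of_nonneg_left h12 (by positivity)
  have h3s1 : (3 : ℝ) ^ s ≤ 3 := by
    calc (3 : ℝ) ^ s ≤ (3 : ℝ) ^ (1 : ℝ) := Real.rpow_le_rpow_of_exponent_le (by norm_num) hs1
      _ = 3 := Real.rpow_one 3
  have hT2s : (T : ℝ) ^ (2 - s) ≤ (k₀ : ℝ) ^ 2 * (L : ℝ) ^ (2 - s) := by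
    calc (T : ℝ) ^ (2 - s) ≤ ((k₀ : ℝ) * L) ^ (2 - s) := Real.rpow_le_rpow hT0.le hTr (by linarith)
      _ = (k₀ : ℝ) ^ (2 - s) * (L : ℝ) ^ (2 - s) := Real.mul_rpow (by positivity) (by positivity)
      _ ≤ (k₀ : ℝ) ^ (2 : ℝ) * (L : ℝ) ^ (2 - s) :=
          mul_le_mul_of_nonneg_right (Real.rpow_le_rpow_of_exponent_le hk₀1r (by linarith))
            (Real.rpow_nonneg hL0.le _)
      _ = (k₀ : ℝ) ^ 2 * (L : ℝ) ^ (2 - s) := by rw [Real.rpow_two]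
  have hT2 : (T : ℝ) ^ 2 * (L : ℝ) ^ (-s) ≤ (k₀ : ℝ) ^ 2 * (L : ℝ) ^ (2 - s) := by
    have h1 : (T : ℝ) ^ 2 ≤ ((k₀ : ℝ) * L) ^ 2 := pow_le_pow_left₀ hT0.le hTr 2
    calc (T : ℝ) ^ 2 * (L : ℝ) ^ (-s) ≤ ((k₀ : ℝ) * L) ^ 2 * (L : ℝ) ^ (-s) :=
          mul_le_mul_of_nonneg_right h1 hLs
      _ = (k₀ : ℝ) ^ 2 * ((L : ℝ) ^ (2 : ℝ) * (L : ℝ) ^ (-s)) := by rw [Real.rpow_two]; ring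
      _ = (k₀ : ℝ) ^ 2 * (L : ℝ) ^ (2 - s) := by rw [← Real.rpow_add hL0, sub_eq_add_neg]
  have hTT : (T : ℝ) * (T : ℝ) ^ (1 - s) = (T : ℝ) ^ (2 - s) := by
    rw [show (2 : ℝ) - s = 1 + (1 - s) by ring, Real.rpow_add hT0, Real.rpow_one]
  calc ∑ t ∈ Finset.Ico R₀ T, (((box 2 (t + 1) \ box 2 t).card : ℕ) : ℝ) *
        (C₁ ^ 2 * ((3 : ℝ) ^ s * ((t : ℝ) + 1) ^ (-s) + (L : ℝ) ^ (-s)))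
      ≤ ∑ t ∈ Finset.Ico R₀ T, 8 * C₁ ^ 2 * ((3 : ℝ) ^ s * (T : ℝ) ^ (1 - s) + (T : ℝ) * (L : ℝ) ^ (-s)) :=
        Finset.sum_le_sum hterm
    _ = ((T - R₀ : ℕ) : ℝ) * (8 * C₁ ^ 2 * ((3 : ℝ) ^ s * (T : ℝ) ^ (1 - s) + (T : ℝ) * (L : ℝ) ^ (-s))) := by
        rw [Finset.sum_const, Nat.card_Ico, nsmul_eq_mul]
    _ ≤ (T : ℝ) * (8 * C₁ ^ 2 * ((3 : ℝ) ^ s * (T : ℝ) ^ (1 - s) + (T : ℝ) * (L : ℝ) ^ (-s))) :=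
        mul_le_mul_of_nonneg_right (by exact_mod_cast Nat.sub_le T R₀) (by positivity)
    _ = 8 * C₁ ^ 2 * ((3 : ℝ) ^ s * ((T : ℝ) * (T : ℝ) ^ (1 - s)) + (T : ℝ) ^ 2 * (L : ℝ) ^ (-s)) := by
        ring
    _ = 8 * C₁ ^ 2 * ((3 : ℝ) ^ s * (T : ℝ) ^ (2 - s) + (T : ℝ) ^ 2 * (L : ℝ) ^ (-s)) := by rw [hTT]
    _ ≤ 8 * C₁ ^ 2 * (3 * ((k₀ : ℝ) ^ 2 * (L : ℝ) ^ (2 - s)) + (k₀ : ℝ) ^ 2 * (L : ℝ) ^ (2 - s)) := by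
        have h1 : (3 : ℝ) ^ s * (T : ℝ) ^ (2 - s) ≤ 3 * ((k₀ : ℝ) ^ 2 * (L : ℝ) ^ (2 - s)) :=
          mul_le_mul h3s1 hT2s (Real.rpow_nonneg hT0.le _) (by norm_num)
        exact mul_le_mul_of_nonneg_left (add_le_add h1 hT2) (by positivity)
    _ = 32 * C₁ ^ 2 * (k₀ : ℝ) ^ 2 * (L : ℝ) ^ (2 - s) := by ring

/-- **`k₀² = O(L^{η/2})`**: if `k₀ ≤ (4/c) log L + 2`, `L ≥ 1`, then `k₀² ≤ (16/(cη) + 2)² L^{η/2}`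
(`log L ≤ (4/η) L^{η/4}`). [folklore] -/
theorem sq_le_rpow_of_le_log {L k₀ : ℕ} {c η : ℝ} (hL1 : 1 ≤ L) (hc : 0 < c) (hη : 0 < η)
    (hk₀le : (k₀ : ℝ) ≤ 4 / c * Real.log L + 2) :
    (k₀ : ℝ) ^ 2 ≤ (16 / (c * η) + 2) ^ 2 * (L : ℝ) ^ (η / 2) := by
  have hL1r : (1 : ℝ) ≤ L := by exact_mod_cast hL1
  have hL0 : (0 : ℝ) < L := by linarith
  have hlog : Real.log L ≤ (L : ℝ) ^ (η / 4) / (η / 4) := Real.log_le_rpow_div hL0.le (by positivity)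
  have hLη : 1 ≤ (L : ℝ) ^ (η / 4) := Real.one_le_rpow hL1r (by positivity)
  have hk₀' : (k₀ : ℝ) ≤ (16 / (c * η) + 2) * (L : ℝ) ^ (η / 4) := by
    have h1 : 4 / c * Real.log L ≤ 16 / (c * η) * (L : ℝ) ^ (η / 4) := by
      calc 4 / c * Real.log L ≤ 4 / c * ((L : ℝ) ^ (η / 4) / (η / 4)) :=
            mul_le_mul_of_nonneg_left hlog (by positivity)
        _ = 16 / (c * η) * (L : ℝ) ^ (η / 4) := by
            field_simp
            ring
    have h2 : (2 : ℝ) ≤ 2 * (L : ℝ) ^ (η / 4) := by linarith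
    calc (k₀ : ℝ) ≤ 4 / c * Real.log L + 2 := hk₀le
      _ ≤ 16 / (c * η) * (L : ℝ) ^ (η / 4) + 2 * (L : ℝ) ^ (η / 4) := add_le_add h1 h2
      _ = (16 / (c * η) + 2) * (L : ℝ) ^ (η / 4) := by ring
  calc (k₀ : ℝ) ^ 2 ≤ ((16 / (c * η) + 2) * (L : ℝ) ^ (η / 4)) ^ 2 :=
        pow_le_pow_left₀ (Nat.cast_nonneg _) hk₀' 2
    _ = (16 / (c * η) + 2) ^ 2 * ((L : ℝ) ^ (η / 4) * (L : ℝ) ^ (η / 4)) := by ring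
    _ = (16 / (c * η) + 2) ^ 2 * (L : ℝ) ^ (η / 2) := by
        rw [← Real.rpow_add hL0]
        congr 2
        ring

/-! ### The upper bound -/

/-- The upper bound for `η ≤ 1/4` with a nonnegative constant (see `triMeanClusterSize_le_rpow_at`). [cite: Nolin2008, §7.5, Lemma 42, Prop. 43 and the display after it (arXiv 0711.4948 numbering)] -/
private theorem triMeanClusterSize_le_rpow_at_aux {ε : ℝ} (h₁ : oneArm_exponent)
    (h27 : ∃ δ > (0 : ℝ), ∃ c > (0 : ℝ), ∃ C : ℝ,
      ∀ p : unitInterval, (p : ℝ) ≠ 1 / 2 → |(p : ℝ) - 1 / 2| < δ →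
        ∀ N ≤ charLength ε p,
          c * critOneArmProb N ≤ (triSitePercolation p).real (triOneArm N) ∧
            (triSitePercolation p).real (triOneArm N) ≤ C * critOneArmProb N)
    (hdec : Nolin2008_radius_decay_at ε) {η : ℝ} (hη : 0 < η) (hη4 : η ≤ 1 / 4) :
    ∃ δ > (0 : ℝ), ∃ L₀ : ℕ, ∃ C : ℝ, 0 ≤ C ∧ ∀ p : unitInterval, (p : ℝ) ≠ 1 / 2 →
      |(p : ℝ) - 1 / 2| < δ → L₀ ≤ charLength ε p →
        triMeanClusterSize p ≤ ENNReal.ofReal (C * (charLength ε p : ℝ) ^ ((43 : ℝ) / 24 + η)) := by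
  classical
  -- constants
  obtain ⟨M₀, hM₀1, hM₀⟩ := critOneArmProb_le_rpow_of_oneArm_exponent h₁ (by positivity : 0 < η / 4)
  obtain ⟨δ₁, hδ₁, c₁, hc₁, C₁, h27'⟩ := h27
  obtain ⟨δ₂, hδ₂, Cd, hCd, cd, hcd, hdec'⟩ := hdec
  have hs0 : 0 < (5 : ℝ) / 24 - η / 2 := by linarith
  have hs1 : (5 : ℝ) / 24 - η / 2 ≤ 1 := by linarith
  have hq1 : Real.exp (-(cd / 2)) < 1 := Real.exp_lt_one_iff.2 (by linarith)
  have hAfar_nn : 0 ≤ 4 * Cd * (32 / cd ^ 2) / (1 - Real.exp (-(cd / 2))) := by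
    have : 0 < 1 - Real.exp (-(cd / 2)) := by linarith
    positivity
  refine ⟨min δ₁ δ₂, lt_min hδ₁ hδ₂, max M₀ (2 * M₀ + 4),
    (2 * ((2 * M₀ + 3 : ℕ) : ℝ) + 1) ^ 2 + 32 * C₁ ^ 2 * (16 / (cd * η) + 2) ^ 2 +
      4 * Cd * (32 / cd ^ 2) / (1 - Real.exp (-(cd / 2))), by positivity,
    fun p hp hpδ hL₀ => ?_⟩
  have hpδ₁ : |(p : ℝ) - 1 / 2| < δ₁ := hpδ.trans_le (min_le_left _ _)
  have hpδ₂ : |(p : ℝ) - 1 / 2| < δ₂ := hpδ.trans_le (min_le_right _ _)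
  -- the length `L` and the scale `k₀` of the far region
  obtain ⟨L, hLdef⟩ : ∃ L : ℕ, L = charLength ε p := ⟨_, rfl⟩
  rw [← hLdef] at hL₀ ⊢
  have hLM : M₀ ≤ L := (le_max_left _ _).trans hL₀
  have hLR : 2 * M₀ + 4 ≤ L := (le_max_right _ _).trans hL₀
  have hL1 : 1 ≤ L := hM₀1.trans hLM
  have hL1r : (1 : ℝ) ≤ L := by exact_mod_cast hL1
  have hL0r : (0 : ℝ) < L := by linarith
  obtain ⟨k₀, hk₀⟩ : ∃ k₀ : ℕ, k₀ = ⌈4 / cd * Real.log L⌉₊ + 1 := ⟨_, rfl⟩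
  have hk₀1 : 1 ≤ k₀ := by rw [hk₀]; exact Nat.le_add_left 1 _
  have hlogL : 0 ≤ Real.log L := Real.log_nonneg hL1r
  have hk₀log : 4 / cd * Real.log L ≤ k₀ := by
    have := Nat.le_ceil (4 / cd * Real.log L)
    rw [hk₀]; push_cast; linarith
  have hk₀le : (k₀ : ℝ) ≤ 4 / cd * Real.log L + 2 := by
    have := Nat.ceil_lt_add_one (show 0 ≤ 4 / cd * Real.log L by positivity)
    rw [hk₀]; push_cast; linarith
  -- the per-site bounds, on far and near shells
  have harm : ∀ m : ℕ, m ≤ L → (triSitePercolation p).real (triOneArm m) ≤ C₁ * critOneArmProb m :=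
    fun m hm => (h27' p hp hpδ₁ m (by rw [← hLdef]; exact hm)).2
  have hfar : ∀ k, k₀ ≤ k → ∀ x ∈ box 2 ((k + 1) * L - 1) \ box 2 (k * L - 1),
      (triSitePercolation p).real (triFinConn 0 x) ≤ Cd * Real.exp (-(cd * k)) := by
    intro k hk x hx
    have hk1 : 1 ≤ k := hk₀1.trans hk
    have h := hdec' p hpδ₂ hp (by rw [← hLdef]; exact hL1) k hk1
    rw [← hLdef] at h
    exact (measureReal_mono (triFinConn_subset_triBoxArm_of_mem_shell hL1 hk1 hx)).trans h
  have hnear : ∀ t, 2 * M₀ + 3 ≤ t → ∀ x ∈ box 2 (t + 1) \ box 2 t,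
      (triSitePercolation p).real (triFinConn 0 x) ≤
        C₁ ^ 2 * ((3 : ℝ) ^ (5 / 24 - η / 2) * ((t : ℝ) + 1) ^ (-(5 / 24 - η / 2)) +
          (L : ℝ) ^ (-(5 / 24 - η / 2))) :=
    fun t ht x hx => real_triFinConn_le_of_mem_shell p hL1 hM₀1 hLM ht (by linarith) harm hM₀ hx
  -- the finite-sum bound
  have hmain : ∀ N : ℕ, ∑ x ∈ box 2 N, (triSitePercolation p).real (triFinConn 0 x) ≤
      ((2 * ((2 * M₀ + 3 : ℕ) : ℝ) + 1) ^ 2 + 32 * C₁ ^ 2 * (16 / (cd * η) + 2) ^ 2 +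
        4 * Cd * (32 / cd ^ 2) / (1 - Real.exp (-(cd / 2)))) * (L : ℝ) ^ ((43 : ℝ) / 24 + η) := by
    intro N
    -- Step A: extend to the far scale `K = N + k₀ + 1` and peel off the far shells
    have hBmono : Monotone fun k : ℕ => box 2 (k * L - 1) := fun a b hab =>
      box_mono 2 (Nat.sub_le_sub_right (Nat.mul_le_mul_right L hab) 1)
    have hk₀K : k₀ ≤ N + k₀ + 1 := by omega
    have hNK : box 2 N ⊆ box 2 ((N + k₀ + 1) * L - 1) := by
      refine box_mono 2 ?_
      have : N + k₀ + 1 ≤ (N + k₀ + 1) * L := Nat.le_mul_of_pos_right _ hL1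
      omega
    have hstepA : ∑ x ∈ box 2 N, (triSitePercolation p).real (triFinConn 0 x) ≤
        ∑ x ∈ box 2 ((N + k₀ + 1) * L - 1), (triSitePercolation p).real (triFinConn 0 x) :=
      Finset.sum_le_sum_of_subset_of_nonneg hNK fun x _ _ => measureReal_nonneg
    have hshellsA := sum_le_sum_add_sum_shells (fun k : ℕ => box 2 (k * L - 1)) hBmono
      (fun x => (triSitePercolation p).real (triFinConn 0 x)) (fun k => Cd * Real.exp (-(cd * k))) k₀
      hfar (N + k₀ + 1) hk₀K
    have hfarsum := far_shell_sum_le hL1 hk₀1 hCd hcd hk₀log (N + k₀ + 1)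
    -- Step B: the near region `Σ_{S_{k₀L-1}}`, peeled into square shells from `R₀ = 2M₀ + 3`
    have hk₀L : 1 ≤ k₀ * L := Nat.mul_le_mul hk₀1 hL1
    have hRT : 2 * M₀ + 3 ≤ k₀ * L - 1 := by
      have : L ≤ k₀ * L := Nat.le_mul_of_pos_left L hk₀1
      omega
    have hT1 : 1 ≤ k₀ * L - 1 := by omega
    have hshellsB := sum_le_sum_add_sum_shells (fun t : ℕ => box 2 t) (box_mono 2)
      (fun x => (triSitePercolation p).real (triFinConn 0 x)) _ (2 * M₀ + 3) hnear (k₀ * L - 1) hRT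
    have hA0sum : ∑ x ∈ box 2 (2 * M₀ + 3), (triSitePercolation p).real (triFinConn 0 x) ≤
        (2 * ((2 * M₀ + 3 : ℕ) : ℝ) + 1) ^ 2 := by
      calc ∑ x ∈ box 2 (2 * M₀ + 3), (triSitePercolation p).real (triFinConn 0 x)
          ≤ ∑ x ∈ box 2 (2 * M₀ + 3), (1 : ℝ) := Finset.sum_le_sum fun x _ => measureReal_le_one
        _ = ((box 2 (2 * M₀ + 3)).card : ℝ) := by simp
        _ = (2 * ((2 * M₀ + 3 : ℕ) : ℝ) + 1) ^ 2 := by rw [card_box]; push_cast; ring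
    have hnearsum := near_shell_sum_le (R₀ := 2 * M₀ + 3) (C₁ := C₁) hs0 hs1 hT1 (Nat.sub_le _ _) hL1 hk₀1
    have hk₀sq := sq_le_rpow_of_le_log hL1 hcd hη hk₀le
    -- assemble
    have hexp_id : (L : ℝ) ^ (η / 2) * (L : ℝ) ^ (2 - (5 / 24 - η / 2)) = (L : ℝ) ^ ((43 : ℝ) / 24 + η) := by
      rw [← Real.rpow_add hL0r]
      congr 1
      ring
    have hLpow1 : 1 ≤ (L : ℝ) ^ ((43 : ℝ) / 24 + η) := Real.one_le_rpow hL1r (by positivity)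
    have hnear' : 32 * C₁ ^ 2 * (k₀ : ℝ) ^ 2 * (L : ℝ) ^ (2 - (5 / 24 - η / 2)) ≤
        32 * C₁ ^ 2 * (16 / (cd * η) + 2) ^ 2 * (L : ℝ) ^ ((43 : ℝ) / 24 + η) := by
      calc 32 * C₁ ^ 2 * (k₀ : ℝ) ^ 2 * (L : ℝ) ^ (2 - (5 / 24 - η / 2))
          ≤ 32 * C₁ ^ 2 * ((16 / (cd * η) + 2) ^ 2 * (L : ℝ) ^ (η / 2)) * (L : ℝ) ^ (2 - (5 / 24 - η / 2)) :=
            mul_le_mul_of_nonneg_right (mul_le_mul_of_nonneg_left hk₀sq (by positivity))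
              (Real.rpow_nonneg hL0r.le _)
        _ = 32 * C₁ ^ 2 * (16 / (cd * η) + 2) ^ 2 * ((L : ℝ) ^ (η / 2) * (L : ℝ) ^ (2 - (5 / 24 - η / 2))) := by
            ring
        _ = 32 * C₁ ^ 2 * (16 / (cd * η) + 2) ^ 2 * (L : ℝ) ^ ((43 : ℝ) / 24 + η) := by rw [hexp_id]
    have hA0_nn : 0 ≤ (2 * ((2 * M₀ + 3 : ℕ) : ℝ) + 1) ^ 2 := by positivity
    have hfin1 : 0 ≤ (2 * ((2 * M₀ + 3 : ℕ) : ℝ) + 1) ^ 2 * ((L : ℝ) ^ ((43 : ℝ) / 24 + η) - 1) :=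
      mul_nonneg hA0_nn (by linarith)
    have hfin2 : 0 ≤ 4 * Cd * (32 / cd ^ 2) / (1 - Real.exp (-(cd / 2))) * ((L : ℝ) ^ ((43 : ℝ) / 24 + η) - 1) :=
      mul_nonneg hAfar_nn (by linarith)
    linarith only [hstepA, hshellsA, hfarsum, hshellsB, hA0sum, hnearsum, hnear', hfin1, hfin2]
  -- conclusion in `ℝ≥0∞`
  rw [triMeanClusterSize_eq_tsum, ENNReal.tsum_eq_iSup_sum]
  refine iSup_le fun t => ?_
  obtain ⟨N, hN⟩ := exists_subset_box t
  calc ∑ x ∈ t, triSitePercolation p (triFinConn 0 x)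
      ≤ ∑ x ∈ box 2 N, triSitePercolation p (triFinConn 0 x) := Finset.sum_le_sum_of_subset hN
    _ = ENNReal.ofReal (∑ x ∈ box 2 N, (triSitePercolation p).real (triFinConn 0 x)) := by
        rw [ENNReal.ofReal_sum_of_nonneg (fun x _ => measureReal_nonneg)]
        exact Finset.sum_congr rfl fun x _ => (ofReal_measureReal (measure_ne_top _ _)).symm
    _ ≤ _ := ENNReal.ofReal_le_ofReal (hmain N)

/-- **Upper bound on the finite-cluster mean size in terms of the characteristic length**: under the
one-arm exponent `π₁(m) = m^{-5/48 + o(1)}` (`oneArm_exponent`), the near-critical stability of one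
arm below `L_ε(p)` (the body of `Nolin2008_thm27_oneArm` at `ε`, upper half) and the radius decay of
finite clusters beyond `L_ε(p)` (`Nolin2008_radius_decay_at ε`), for every `η > 0` there are `δ > 0`,
`L₀` and `C` with `χ^f(p) ≤ C L_ε(p)^{43/24 + η}` for all `p ≠ 1/2` with `|p - 1/2| < δ` and
`L_ε(p) ≥ L₀`. This is the upper half of Nolin's `χ(p) ≍ L(p)² π₁²(L(p)) ≈ L(p)^{86/48}` (Nolin 2008,
§7.5, Lemma 42 and Prop. 43 of arXiv 0711.4948, and the display after Prop. 43), in the logarithmic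
form sufficient for the exponent `γ = 43/18`: the printed proof's a-priori bound
`π₁(n|N) ≥ C (n/N)^{1/2}` and quasi-multiplicativity (Lemma 41) are replaced by the one-arm exponent
itself, at the cost of the `L^η`. Proof: `χ^f(p) = Σ_x P_p(0 ↔ x, |C(0)| < ∞)`
(`triMeanClusterSize_eq_tsum`); sites with sup-norm `ρ ≤ 2M₀ + 3` contribute `O(1)`; a site with
`2M₀ + 3 < ρ < k₀ L` contributes `≤ P_p(0 ↔ ∂Λ_m)² ≤ C₁² π₁(m)² ≤ C₁² m^{-5/24 + η/2}` with
`m = min(L, (ρ-1)/2)` (two disjoint hexagons, `real_triFinConn_le_sq`; one-arm stability; one-arm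
exponent), summed over the square shells `|S_{t+1} ∖ S_t| = 8t + 8` to `≤ 32 C₁² k₀² L^{43/24 + η/2}`;
a site with `ρ ≥ k L`, `k ≥ k₀ = ⌈(4/c) log L⌉ + 1`, contributes `≤ C e^{-ck}` (radius decay,
`triFinConn_subset_triBoxArm_inter`), in total `≤ 4 C (32/c²) L² e^{-c k₀/2} / (1 - e^{-c/2}) = O(1)`;
and `k₀² = O(L^{η/2})`. [cite: Nolin2008, §7.5, Lemma 42, Prop. 43 and the display after it (arXiv 0711.4948 numbering)] -/
theorem triMeanClusterSize_le_rpow_at {ε : ℝ} (h₁ : oneArm_exponent)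
    (h27 : ∃ δ > (0 : ℝ), ∃ c > (0 : ℝ), ∃ C : ℝ,
      ∀ p : unitInterval, (p : ℝ) ≠ 1 / 2 → |(p : ℝ) - 1 / 2| < δ →
        ∀ N ≤ charLength ε p,
          c * critOneArmProb N ≤ (triSitePercolation p).real (triOneArm N) ∧
            (triSitePercolation p).real (triOneArm N) ≤ C * critOneArmProb N)
    (hdec : Nolin2008_radius_decay_at ε) {η : ℝ} (hη : 0 < η) :
    ∃ δ > (0 : ℝ), ∃ L₀ : ℕ, ∃ C : ℝ, ∀ p : unitInterval, (p : ℝ) ≠ 1 / 2 →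
      |(p : ℝ) - 1 / 2| < δ → L₀ ≤ charLength ε p →
        triMeanClusterSize p ≤ ENNReal.ofReal (C * (charLength ε p : ℝ) ^ ((43 : ℝ) / 24 + η)) := by
  obtain ⟨δ, hδ, L₀, C, hC0, h⟩ := triMeanClusterSize_le_rpow_at_aux h₁ h27 hdec
    (lt_min hη (by norm_num : (0 : ℝ) < 1 / 4)) (min_le_right _ _)
  refine ⟨δ, hδ, max L₀ 1, C, fun p hp hpδ hL => (h p hp hpδ ((le_max_left _ _).trans hL)).trans ?_⟩
  refine ENNReal.ofReal_le_ofReal (mul_le_mul_of_nonneg_left ?_ hC0)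
  have hL1 : (1 : ℝ) ≤ charLength ε p := by exact_mod_cast (le_max_right _ _).trans hL
  exact Real.rpow_le_rpow_of_exponent_le hL1 (by linarith [min_le_left η (1 / 4)])

/-- The same from the named facts `oneArm_exponent`, `Nolin2008_thm27_oneArm` and
`Nolin2008_radius_decay_at ε` at a fixed `ε ∈ (0, 1/2)`. [cite: Nolin2008, §7.5, Prop. 43 and the display after it (arXiv 0711.4948 numbering)] -/
theorem triMeanClusterSize_le_rpow (h₁ : oneArm_exponent) (h27 : Nolin2008_thm27_oneArm) {ε : ℝ}
    (hε : 0 < ε) (hε' : ε < 1 / 2) (hdec : Nolin2008_radius_decay_at ε) {η : ℝ} (hη : 0 < η) :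
    ∃ δ > (0 : ℝ), ∃ L₀ : ℕ, ∃ C : ℝ, ∀ p : unitInterval, (p : ℝ) ≠ 1 / 2 →
      |(p : ℝ) - 1 / 2| < δ → L₀ ≤ charLength ε p →
        triMeanClusterSize p ≤ ENNReal.ofReal (C * (charLength ε p : ℝ) ^ ((43 : ℝ) / 24 + η)) :=
  triMeanClusterSize_le_rpow_at h₁ (h27 hε hε') hdec hη

end Literature.Probability.Percolation
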